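import Mathlib.LinearAlgebra.TensorProduct.Tower
import Mathlib.LinearAlgebra.Determinant
import Mathlib.LinearAlgebra.Dimension.Finrank
import Mathlib.RingTheory.Valuation.Basic
import Mathlib.RingTheory.TensorProduct.Basic
import Mathlib.Algebra.Order.WithTop.Untop0
import Mathlib.Algebra.BigOperators.Finprod
import Literature.NumberTheory.GaloisRepresentations.PAdicHodge
import HarnessLib

/-!
# Filtered `φ`-modules, weak admissibility, and `V_cris` (absolutely unramified base)

Fontaine's *filtered `φ`-modules with coefficients* over an **absolutely unramified** `p`-adic
base field `F₀ = K = K₀` (the case `K = ℚ_p`, `K = ℚ_{p^f}` of Berger, Dousmanis, Guzmán,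
Rozensztajn), their Hodge and Newton numbers `t_H`, `t_N`, **weak admissibility**
(Fontaine; Colmez–Fontaine), and — relative to a crystalline period-ring datum
`𝔅 : CrystallinePeriodRingData P F` of `PAdicHodge.lean` (intended: `B_cris`) — the functor
`D ↦ V_cris(D) = Fil⁰(D ⊗_{F₀} B)^{φ = 1}` with its `Γ_F`-action
(`FilteredPhiModule.crystallineRepOfWeaklyAdmissible`), Fontaine's notion of an *admissible*
`D`, and the Colmez–Fontaine property "weakly admissible ⇒ admissible" of the datum.

## Main definitions

* `FilteredPhiModule P σ E`: for a coefficient field `P` (plays `ℚ_p`), a field `F₀ ⊇ P`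
  (plays `K₀ = W(k)[1/p]`, here equal to `K`) with a ring endomorphism `σ` (Frobenius) and a
  coefficient field `E ⊇ P`: a finite-dimensional `F₀`-vector space `D` with a commuting
  `E`-action (an `F₀ ⊗_P E`-module), a bijective `σ`-semilinear, `E`-linear `φ : D → D`, and a
  decreasing, exhaustive, separated filtration `Fil^i D` by `E`-stable `F₀`-subspaces
  (BrinonConrad2009 §8 for `E = ℚ_p`; with coefficients: Dousmanis2010 §1, Guzman2024 §2.1,
  Breuil–Mézard).  The carrier is bundled (field `carrier`, with a `CoeSort`).
* `FilteredPhiModule.IsStable D W`: the `F₀`-subspace `W` is `φ`-stable (a *sub-object*, with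
  the induced filtration `W ∩ Fil^i D`).
* `FilteredPhiModule.tH D W`, `FilteredPhiModule.tN v D W hW`: Hodge and Newton numbers of the
  sub-object `W`, computed **after restriction of scalars to `P`** (see Design): `t_H` is
  `∑ i · dim_P grⁱ W` (BrinonConrad2009 Def. 8.1.1) and `t_N` is the additive valuation
  `v (det_P (φ|_W))` of the `P`-linear map `φ|_W` (BrinonConrad2009 Prop. 8.1.9:
  `t_N(D) = t_N(det D) = ord_p` of `φ` on the top exterior power).
* `FilteredPhiModule.IsWeaklyAdmissible v D`: `t_H(D) = t_N(D)` and `t_H(W) ≤ t_N(W)` for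
  every sub-object `W` (BrinonConrad2009 Def. 8.2.1; Fontaine).
* `FilteredPhiModule.IsFreeOfRank n D`: `D` is free of rank `n` over `F₀ ⊗_P E`.
* `FilteredPhiModule.Equiv D₁ D₂`: isomorphisms of filtered `φ`-modules.
* Relative to `𝔅 : CrystallinePeriodRingData P F` with `F₀ = 𝔅.F₀`, a Frobenius `σ` of `F₀`
  compatible with `𝔅.frob` (`hσ`), and `D : FilteredPhiModule P σ E`:
  `FilteredPhiModule.tensorFrob` (`φ_D ⊗ φ_B` on `D ⊗_{F₀} B`, `σ`-semilinear),
  `FilteredPhiModule.filTensor` (`Filⁿ(D ⊗ B) = ∑_i Filⁱ D ⊗ Filⁿ⁻ⁱ B`),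
  `FilteredPhiModule.Vcris` (the `E`-subspace `Fil⁰(D ⊗_{F₀} B)^{φ=1}`, BrinonConrad2009
  (9.2.3) with `N = 0`), and
  **`FilteredPhiModule.crystallineRepOfWeaklyAdmissible 𝔅 σ hσ D :
  Representation E (Γ_F) (Vcris)`** — the `E`-linear Galois representation `V_cris(D)`
  attached to `D` (Colmez–Fontaine: for `𝔅 = B_cris` and `D` weakly admissible this is THE
  crystalline representation with `D_cris(V) ≅ D`, ColmezFontaine2000 Thm. A; e.g. the dual
  `V_{k,a_p}^*` of Berger's `V_{k,a_p}` from `D_{k,a_p}`, Berger2011 §1).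
* `FilteredPhiModule.IsAdmissible 𝔅 σ hσ D`: `dim_P V_cris(D) = dim_{F₀} D` (Fontaine's
  *admissible* modules, BrinonConrad2009 Def. 9.3.8 in the form of Prop. 9.3.9).
* `CrystallinePeriodRingData.WeaklyAdmissibleImpliesAdmissible 𝔅 σ hσ v E`: every weakly
  admissible `D` with coefficients `E` is admissible relative to `𝔅` — the content of
  Colmez–Fontaine's Théorème A for the genuine `B_cris`, as a **predicate on the datum**.

## Design choices

* **Absolutely unramified base only.**  For general `K ⊋ K₀` the filtration lives on
  `K ⊗_{K₀} D`; here `K = K₀ = F₀` and `Fil` is on `D` itself (Guzman2024 Rem. 1.2.1).  The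
  ramified case is deliberately NOT formalised in this file.
* **`P`-normalised `t_H`, `t_N`.**  `φ` is only `σ`-semilinear over `F₀`, so `det_{F₀} φ` is
  basis-dependent (BrinonConrad2009 Ex. 8.1.3), but `φ` is `P`-linear (`E`-linear, and `P`
  acts through `E`), so `det_P (φ|_W) ∈ P` is intrinsic (Mathlib `LinearMap.det`).  For
  `F₀/P` finite Galois of degree `f` with `σ` a generator of finite order and `v` extended
  `σ`-invariantly, `v(det_P φ|_W) = f · t_N(W)` (norm of the semilinear determinant times a
  root of unity) and `∑ i dim_P grⁱ = f · t_H(W)`, so the defining (in)equalities of weak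
  admissibility are *equivalent* to Fontaine's; for `F₀ = P` (`K = ℚ_p`, `σ = id`) they are
  literally Fontaine's numbers.  This avoids choosing bases and the Dieudonné–Manin slope
  theory.  `tH`, `tN`, `IsWeaklyAdmissible` (and `WeaklyAdmissibleImpliesAdmissible`) therefore
  REQUIRE `[FiniteDimensional P F₀]` (otherwise `finrank P` and `LinearMap.det` would be the
  Mathlib junk values `0`, `1` and weak admissibility would be vacuous); the intended `F₀` is a
  finite unramified extension of `P = ℚ_p`.  Remaining junk value: `t_N` of a non-injective
  restriction is `v 0 = ⊤ ↦ 0` (`WithTop.untop₀`), impossible for bijective `φ` and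
  bijective `σ`.
* **Sub-objects are all `φ`-stable `F₀`-subspaces** (with coefficients it suffices to test
  `E`-stable ones — Breuil–Mézard, Prop. 3.1.1.5 — a theorem we do not use).
* **Everything on the period side is relative to a datum** (`PAdicHodge.lean` design): no
  period ring is constructed; `V_cris(D) ⊆ D ⊗_{F₀} B` is an honest `E[Γ_F]`-module for any
  datum (`E` acts through `D`, `Γ_F` through `B`), WITHOUT topology (the datum carries none;
  for the genuine `B_cris`, continuity on finite-dimensional stable subspaces is automatic,
  BrinonConrad2009 Prop. 9.3.6).  `IsAdmissible` and `WeaklyAdmissibleImpliesAdmissible`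
  are *predicates* with explicit binders, not closed named facts: their universal closure over
  all data is false (cf. `PeriodRingData.not_forall_isAdmissible`), exactly as for
  `PeriodRingData.IsAdmissible`.  Consumers assume `(h𝔅 : 𝔅.WeaklyAdmissibleImpliesAdmissible
  σ hσ v E)` next to the datum.
* The compatibility `hσ : ∀ e, 𝔅.frob (algebraMap e) = algebraMap (σ e)` (Frobenius of `B`
  restricts to `σ` on `F₀ = B^{Γ_F}`) is a hypothesis, so that `D`'s type does not depend on
  `𝔅`.
* NOT here: the explicit families `D_{k,a_p}` (Berger2011) / `D(A)` (Dousmanis2010,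
  Guzman2024), Wach modules, `D_cris(V)` as a `FilteredPhiModule` (the Frobenius on
  `PeriodRingData.D`), full faithfulness — follow-up files.

## References

* O. Brinon, B. Conrad, *CMI Summer School notes on p-adic Hodge theory* (2009), §8.1–8.2
  (Def. 8.1.1, 8.1.7, Prop. 8.1.9, Def. 8.2.1), §9.2 (9.2.3), §9.3 (Def. 9.3.8, Prop. 9.3.9).
* P. Colmez, J.-M. Fontaine, *Construction des représentations p-adiques semi-stables*,
  Invent. Math. 140 (2000), Théorème A.
* J.-M. Fontaine, Astérisque 223 (1994), Exposé III §4–5.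
* L. Berger, Bull. LMS 44 (2011) (arXiv:0907.0221), §1 (`D_{k,a_p}`, `V_{k,a_p}`).
* G. Dousmanis, Doc. Math. 15 (2010) §1–2; A. Guzmán, arXiv:2410.00729 §2.1 (unramified `K`,
  coefficients, Thm. 2.1.3).
-/

noncomputable section

open scoped TensorProduct
open Field TensorProduct

namespace Literature.NumberTheory.GaloisRepresentations

universe u v v' w w'

/-! ### Filtered `φ`-modules with coefficients over an absolutely unramified base -/

section Module

variable (P : Type v) [Field P] {F₀ : Type v'} [Field F₀] [Algebra P F₀]

/-- A **filtered `φ`-module over the absolutely unramified base `F₀` (`= K = K₀`) with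
coefficients in `E`**, relative to the Frobenius lift `σ : F₀ →+* F₀` and the prime field
`P ⊆ F₀, E` (plays `ℚ_p`): a finite-dimensional `F₀`-vector space `D` (`carrier`) with a
commuting `E`-action compatible with `P` (so `D` is an `F₀ ⊗_P E`-module), a bijective
`σ`-semilinear and `E`-linear Frobenius `phi : D → D`, and a decreasing (`fil_antitone`),
exhaustive (`exists_fil_eq_top`), separated (`exists_fil_eq_bot`) filtration
`fil : ℤ → Submodule F₀ D` by `E`-stable subspaces.  No compatibility between `phi` and `fil`
is imposed.  For `K = ℚ_p`: `F₀ = P`, `σ = id`.  The ramified case (`Fil` on `K ⊗_{K₀} D`) is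
not covered.
Ref: BrinonConrad2009 §8 (filtered `φ`-modules over `K`, `MF^φ_K`); with coefficients
Guzman2024 §2.1, Dousmanis2010 §1. [cite: BrinonConrad2009, §8.1] -/
structure FilteredPhiModule (σ : F₀ →+* F₀) (E : Type u) [Field E] [Algebra P E] :
    Type (max u v v' (w + 1)) where
  /-- The underlying `F₀`-vector space `D`. -/
  carrier : Type w
  /-- `D` is an additive commutative group. -/
  [addCommGroup : AddCommGroup carrier]
  /-- `D` is an `F₀`-vector space. -/
  [moduleF₀ : Module F₀ carrier]
  /-- The coefficient action of `E` on `D`. -/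
  [moduleE : Module E carrier]
  /-- The action of the prime field `P` on `D`. -/
  [moduleP : Module P carrier]
  /-- `P` acts through `F₀`. -/
  [isScalarTowerF₀ : IsScalarTower P F₀ carrier]
  /-- `P` acts through `E`. -/
  [isScalarTowerE : IsScalarTower P E carrier]
  /-- The `F₀`- and `E`-actions commute (`D` is an `F₀ ⊗_P E`-module). -/
  [smulCommClass : SMulCommClass F₀ E carrier]
  /-- `D` is finite-dimensional over `F₀`. -/
  [finite : Module.Finite F₀ carrier]
  /-- The Frobenius `φ`, a `σ`-semilinear endomorphism of `D`. -/
  phi : carrier →ₛₗ[σ] carrier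
  /-- `φ` is `E`-linear. -/
  phi_smul : ∀ (e : E) (x : carrier), phi (e • x) = e • phi x
  /-- `φ` is bijective. -/
  phi_bijective : Function.Bijective phi
  /-- The decreasing filtration `Fil^i D`, `i : ℤ`, by `F₀`-subspaces. -/
  fil : ℤ → Submodule F₀ carrier
  /-- Each `Fil^i D` is `E`-stable. -/
  smul_mem_fil : ∀ (e : E) (i : ℤ) (x : carrier), x ∈ fil i → e • x ∈ fil i
  /-- The filtration is decreasing. -/
  fil_antitone : Antitone fil
  /-- The filtration is exhaustive: `Fil^i D = D` for some `i`. -/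
  exists_fil_eq_top : ∃ i, fil i = ⊤
  /-- The filtration is separated: `Fil^i D = 0` for some `i`. -/
  exists_fil_eq_bot : ∃ i, fil i = ⊥

namespace FilteredPhiModule

attribute [instance] addCommGroup moduleF₀ moduleE moduleP isScalarTowerF₀ isScalarTowerE
  smulCommClass finite

variable {P} {σ : F₀ →+* F₀} {E : Type u} [Field E] [Algebra P E]

/-- A filtered `φ`-module coerces to its underlying type. [folklore] -/
instance instCoeSort : CoeSort (FilteredPhiModule.{u, v, v', w} P σ E) (Type w) :=
  ⟨FilteredPhiModule.carrier⟩

variable (D : FilteredPhiModule.{u, v, v', w} P σ E)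

/-- The `E`- and `F₀`-actions on `D` commute (symmetric form of `smulCommClass`). [folklore] -/
instance instSMulCommClassE : SMulCommClass E F₀ D := SMulCommClass.symm F₀ E D

/-- The Frobenius of a filtered `φ`-module with coefficients is `P`-linear (it is `E`-linear
and `P` acts through `E`). [folklore] -/
def phiP : D →ₗ[P] D where
  toFun := D.phi
  map_add' := map_add D.phi
  map_smul' c x := by
    rw [RingHom.id_apply, ← algebraMap_smul E c x, D.phi_smul, algebraMap_smul]

/-- Unfolding lemma for `phiP`. [folklore] -/
@[simp] lemma phiP_apply (x : D) : D.phiP x = D.phi x := rfl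

/-- `W ⊆ D` is a **sub-object**: an `F₀`-subspace stable under `φ` (it carries the induced
filtration `W ∩ Fil^i D`).
Ref: BrinonConrad2009 §8.1 (subobjects in `MF^φ_K`). [cite: BrinonConrad2009, Def. 8.2.1] -/
def IsStable (W : Submodule F₀ D) : Prop :=
  ∀ x ∈ W, D.phi x ∈ W

/-- The whole module is a sub-object. [folklore] -/
lemma isStable_top : D.IsStable ⊤ := fun _ _ => Submodule.mem_top

section FiniteBase

/-! The Hodge and Newton numbers are computed after restriction of scalars to `P`, which is
faithful only for `F₀/P` finite: `[FiniteDimensional P F₀]` is required from here on. -/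

/-- The **Hodge number** of the sub-object `W` (with its induced filtration `W ∩ Fil^i D`),
normalised over `P` (for `F₀/P` finite, as required): `t_H(W) = ∑_i i · dim_P grⁱ(W) =
∑_i i · (dim_P (W ∩ Filⁱ) - dim_P (W ∩ Filⁱ⁺¹))` (a finite sum: `finsum`; equals `[F₀ : P]`
times the `F₀`-normalised Hodge number of BrinonConrad2009 Def. 8.1.1).
Ref: BrinonConrad2009, Def. 8.1.1 (`t_H(D) = ∑ i · dim grⁱ D`). [cite: BrinonConrad2009, Def. 8.1.1] -/
def tH [FiniteDimensional P F₀] (W : Submodule F₀ D) : ℤ :=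
  ∑ᶠ i : ℤ, i * ((Module.finrank P ↥(W ⊓ D.fil i) : ℤ) - Module.finrank P ↥(W ⊓ D.fil (i + 1)))

/-- The **Newton number** of the `φ`-stable sub-object `W`, normalised over `P` (for `F₀/P`
finite, as required): `t_N(W) = v (det_P (φ|_W))`, the additive valuation of the determinant
of `φ|_W` regarded as a `P`-linear endomorphism of the finite-dimensional `P`-space `W`
(intrinsic; equals `[F₀ : P]` times `ord_p` of the semilinear determinant, i.e. of `φ` on
`det W`, BrinonConrad2009 Prop. 8.1.9, when `σ` has finite order and `v` is the `p`-adic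
valuation).  Junk: `untop₀ ⊤ = 0` if the determinant vanishes.
Ref: BrinonConrad2009, Def. 8.1.7 and Prop. 8.1.9 (`t_N(D) = t_N(det D)`). [cite: BrinonConrad2009, Prop. 8.1.9] -/
def tN [FiniteDimensional P F₀] (v : AddValuation P (WithTop ℤ)) (W : Submodule F₀ D)
    (hW : D.IsStable W) : ℤ :=
  (v (LinearMap.det
    (D.phiP.restrict (p := W.restrictScalars P) (q := W.restrictScalars P) hW))).untop₀

/-- `D` is **weakly admissible** (Fontaine): `t_H(D) = t_N(D)`, and `t_H(W) ≤ t_N(W)` for every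
sub-object `W ⊆ D` (every `φ`-stable `F₀`-subspace with its induced filtration).  The numbers
are the `P`-normalised ones (`tH`, `tN`), a common positive multiple (`[F₀ : P]`, finite by
the standing requirement `[FiniteDimensional P F₀]`) of Fontaine's, so the condition is
Fontaine's.
Ref: BrinonConrad2009, Def. 8.2.1; Colmez–Fontaine (2000) §3. [cite: BrinonConrad2009, Def. 8.2.1] -/
def IsWeaklyAdmissible [FiniteDimensional P F₀] (v : AddValuation P (WithTop ℤ))
    (D : FilteredPhiModule.{u, v, v', w} P σ E) : Prop :=
  D.tH ⊤ = D.tN v ⊤ D.isStable_top ∧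
    ∀ (W : Submodule F₀ D) (hW : D.IsStable W), D.tH W ≤ D.tN v W hW

end FiniteBase

/-- `D` is **free of rank `n`** over `F₀ ⊗_P E` (the `F₀ ⊗_P E`-module structure on `D` is
Mathlib's `TensorProduct.Algebra.module` for the two commuting actions).
Ref: Guzman2024 §2.1 (rank-`d` filtered `φ`-modules over `K ⊗_{ℚ_p} F`). [cite: Guzman2024, §2.1] -/
def IsFreeOfRank (n : ℕ) (D : FilteredPhiModule.{u, v, v', w} P σ E) : Prop :=
  letI := TensorProduct.Algebra.module (R := P) (A := F₀) (B := E) (M := D)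
  Module.Free (F₀ ⊗[P] E) D ∧ Module.finrank (F₀ ⊗[P] E) D = n

/-- An **isomorphism of filtered `φ`-modules**: an `F₀`-linear and `E`-linear bijection
commuting with `φ` and mapping `Fil^i` onto `Fil^i`.
Ref: BrinonConrad2009 §8 (morphisms in `MF^φ_K`); Guzman2024 §2.1. [cite: BrinonConrad2009, §8.1] -/
structure Equiv (D₁ D₂ : FilteredPhiModule.{u, v, v', w} P σ E) where
  /-- The underlying `F₀`-linear isomorphism. -/
  toLinearEquiv : D₁ ≃ₗ[F₀] D₂
  /-- `E`-linearity. -/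
  map_smul : ∀ (e : E) (x : D₁), toLinearEquiv (e • x) = e • toLinearEquiv x
  /-- Compatibility with Frobenius. -/
  map_phi : ∀ x : D₁, toLinearEquiv (D₁.phi x) = D₂.phi (toLinearEquiv x)
  /-- The filtrations correspond. -/
  map_fil : ∀ i : ℤ, (D₁.fil i).map (toLinearEquiv : D₁ →ₗ[F₀] D₂) = D₂.fil i

/-- The identity isomorphism. [folklore] -/
def Equiv.refl : D.Equiv D where
  toLinearEquiv := LinearEquiv.refl F₀ D
  map_smul _ _ := rfl
  map_phi _ := rfl
  map_fil _ := Submodule.map_id _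

end FilteredPhiModule

end Module

/-! ### `V_cris(D)` relative to a crystalline period-ring datum -/

section Period

variable {P : Type v} [Field P] {F : Type v'} [Field F] [Algebra P F]
  (𝔅 : CrystallinePeriodRingData.{v, v', w} P F)

namespace CrystallinePeriodRingData

/-- The Frobenius `𝔅.frob` of a crystalline period-ring datum as a `σ`-semilinear map over
`F₀`, given the compatibility `hσ` of `𝔅.frob` with the Frobenius `σ` of `F₀ = B^{Γ_F}`.
Ref: Fontaine, Astérisque 223 (1994), Exposé II §2.3 (`φ` on `B_cris` is `σ`-semilinear). [folklore] -/
def frobSemilinear (σ : 𝔅.F₀ →+* 𝔅.F₀)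
    (hσ : ∀ e : 𝔅.F₀, 𝔅.frob (algebraMap 𝔅.F₀ 𝔅.toPeriodRingData.B e) =
      algebraMap 𝔅.F₀ 𝔅.toPeriodRingData.B (σ e)) :
    𝔅.toPeriodRingData.B →ₛₗ[σ] 𝔅.toPeriodRingData.B where
  toFun := 𝔅.frob
  map_add' := map_add 𝔅.frob
  map_smul' e b := by
    rw [Algebra.smul_def, map_mul, hσ, ← Algebra.smul_def]

/-- Unfolding lemma for `frobSemilinear`. [folklore] -/
@[simp] lemma frobSemilinear_apply (σ : 𝔅.F₀ →+* 𝔅.F₀)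
    (hσ : ∀ e : 𝔅.F₀, 𝔅.frob (algebraMap 𝔅.F₀ 𝔅.toPeriodRingData.B e) =
      algebraMap 𝔅.F₀ 𝔅.toPeriodRingData.B (σ e)) (b : 𝔅.toPeriodRingData.B) :
    𝔅.frobSemilinear σ hσ b = 𝔅.frob b := rfl

end CrystallinePeriodRingData

namespace FilteredPhiModule

variable {σ : 𝔅.F₀ →+* 𝔅.F₀}
  (hσ : ∀ e : 𝔅.F₀, 𝔅.frob (algebraMap 𝔅.F₀ 𝔅.toPeriodRingData.B e) =
    algebraMap 𝔅.F₀ 𝔅.toPeriodRingData.B (σ e))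
  {E : Type u} [Field E] [Algebra P E] (D : FilteredPhiModule.{u, v, v', w'} P σ E)

/-- The Frobenius `φ_D ⊗ φ_B` on `D ⊗_{F₀} B`, a `σ`-semilinear map (Mathlib's
`TensorProduct.map` of two `σ`-semilinear maps).
Ref: BrinonConrad2009 §9.2, (9.2.3) (tensor-product Frobenius on `B ⊗_{K₀} D`). [folklore] -/
def tensorFrob : D ⊗[𝔅.F₀] 𝔅.toPeriodRingData.B →ₛₗ[σ] D ⊗[𝔅.F₀] 𝔅.toPeriodRingData.B :=
  TensorProduct.map D.phi (𝔅.frobSemilinear σ hσ)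

/-- `tensorFrob` on pure tensors. [folklore] -/
@[simp] lemma tensorFrob_tmul (d : D) (b : 𝔅.toPeriodRingData.B) :
    D.tensorFrob 𝔅 hσ (d ⊗ₜ b) = D.phi d ⊗ₜ 𝔅.frob b := rfl

/-- `tensorFrob` is `E`-linear for the coefficient action through `D`. [folklore] -/
lemma tensorFrob_smul (e : E) (x : D ⊗[𝔅.F₀] 𝔅.toPeriodRingData.B) :
    D.tensorFrob 𝔅 hσ (e • x) = e • D.tensorFrob 𝔅 hσ x := by
  induction x using TensorProduct.induction_on with
  | zero => simp
  | tmul d b => rw [smul_tmul', tensorFrob_tmul, tensorFrob_tmul, D.phi_smul, smul_tmul']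
  | add x y hx hy => rw [smul_add, map_add, map_add, smul_add, hx, hy]

/-- The filtration **`Filⁿ(D ⊗_{F₀} B) = ∑_i Filⁱ D ⊗ Filⁿ⁻ⁱ B`** (images of
`Filⁱ D ⊗ Filⁿ⁻ⁱ B → D ⊗ B`), an `F₀`-subspace.
Ref: BrinonConrad2009 §9.2 (tensor-product filtration), §6.2. [folklore] -/
def filTensor (n : ℤ) : Submodule 𝔅.F₀ (D ⊗[𝔅.F₀] 𝔅.toPeriodRingData.B) :=
  ⨆ i : ℤ, LinearMap.range (TensorProduct.mapIncl (D.fil i) (𝔅.toPeriodRingData.fil (n - i)))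

/-- Pure tensors `d ⊗ b` with `d ∈ Filⁱ D`, `b ∈ Filʲ B` lie in `Filⁱ⁺ʲ(D ⊗ B)`. [folklore] -/
lemma tmul_mem_filTensor {i j n : ℤ} (h : i + j = n) {d : D} {b : 𝔅.toPeriodRingData.B}
    (hd : d ∈ D.fil i) (hb : b ∈ 𝔅.toPeriodRingData.fil j) :
    d ⊗ₜ b ∈ D.filTensor 𝔅 n := by
  refine Submodule.mem_iSup_of_mem i ⟨⟨d, hd⟩ ⊗ₜ ⟨b, h ▸ (by simpa using hb)⟩, rfl⟩

/-- The coefficient action of `e : E` on `D ⊗_{F₀} B`, as an `F₀`-linear map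
(`(e • ·) ⊗ id`). [folklore] -/
def smulTensor (e : E) : D ⊗[𝔅.F₀] 𝔅.toPeriodRingData.B →ₗ[𝔅.F₀] D ⊗[𝔅.F₀] 𝔅.toPeriodRingData.B :=
  LinearMap.rTensor 𝔅.toPeriodRingData.B (DistribSMul.toLinearMap 𝔅.F₀ D e)

/-- `smulTensor e` is the scalar action of `e`. [folklore] -/
lemma smulTensor_apply (e : E) (x : D ⊗[𝔅.F₀] 𝔅.toPeriodRingData.B) :
    D.smulTensor 𝔅 e x = e • x := by
  induction x using TensorProduct.induction_on with
  | zero => simp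
  | tmul d b => rfl
  | add x y hx hy => rw [map_add, smul_add, hx, hy]

/-- An `F₀`-linear endomorphism `T` of `D ⊗ B` which restricts to an endomorphism of each
`Filⁱ D ⊗ Filⁿ⁻ⁱ B` preserves `Filⁿ(D ⊗ B)` (auxiliary). [folklore] -/
lemma map_filTensor_le {n : ℤ}
    {T : D ⊗[𝔅.F₀] 𝔅.toPeriodRingData.B →ₗ[𝔅.F₀] D ⊗[𝔅.F₀] 𝔅.toPeriodRingData.B}
    (hT : ∀ i : ℤ, ∃ S : ↥(D.fil i) ⊗[𝔅.F₀] ↥(𝔅.toPeriodRingData.fil (n - i)) →ₗ[𝔅.F₀]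
        ↥(D.fil i) ⊗[𝔅.F₀] ↥(𝔅.toPeriodRingData.fil (n - i)),
      T ∘ₗ TensorProduct.mapIncl (D.fil i) (𝔅.toPeriodRingData.fil (n - i)) =
        TensorProduct.mapIncl (D.fil i) (𝔅.toPeriodRingData.fil (n - i)) ∘ₗ S) :
    (D.filTensor 𝔅 n).map T ≤ D.filTensor 𝔅 n := by
  simp only [filTensor, Submodule.map_iSup, iSup_le_iff]
  intro i
  obtain ⟨S, hS⟩ := hT i
  rw [← LinearMap.range_comp, hS]
  exact le_iSup_of_le i (LinearMap.range_comp_le_range _ _)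

/-- Each `Filⁿ(D ⊗ B)` is stable under the coefficient action of `E`. [folklore] -/
lemma smul_mem_filTensor (e : E) {n : ℤ} {x : D ⊗[𝔅.F₀] 𝔅.toPeriodRingData.B}
    (hx : x ∈ D.filTensor 𝔅 n) : e • x ∈ D.filTensor 𝔅 n := by
  rw [← smulTensor_apply]
  refine D.map_filTensor_le 𝔅 (T := D.smulTensor 𝔅 e) (fun i => ?_) (Submodule.mem_map_of_mem hx)
  exact ⟨TensorProduct.map ((DistribSMul.toLinearMap 𝔅.F₀ D e).restrict
      (p := D.fil i) (q := D.fil i) (fun x hx => D.smul_mem_fil e i x hx)) LinearMap.id,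
    TensorProduct.ext' fun _ _ => rfl⟩

/-- **`V_cris(D) = Fil⁰(D ⊗_{F₀} B)^{φ = 1}`** relative to the crystalline datum `𝔅`
(intended: `B_cris`): the tensors fixed by `φ_D ⊗ φ_B` and lying in `Fil⁰`, an `E`-subspace
of `D ⊗_{F₀} B` (`E` acting through `D`).  For `𝔅 = B_cris` and `D` weakly admissible this
is Colmez–Fontaine's `E`-linear crystalline representation attached to `D`.
Ref: BrinonConrad2009, (9.2.3) (`V_st(D) = Fil⁰(B_st ⊗_{K₀} D)^{N=0, φ=1}`, `V_cris` for
`N = 0`); ColmezFontaine2000, Thm. A. [cite: BrinonConrad2009, (9.2.3)] -/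
def Vcris : Submodule E (D ⊗[𝔅.F₀] 𝔅.toPeriodRingData.B) where
  carrier := {x | D.tensorFrob 𝔅 hσ x = x ∧ x ∈ D.filTensor 𝔅 0}
  add_mem' {x y} hx hy := ⟨by rw [map_add, hx.1, hy.1], add_mem hx.2 hy.2⟩
  zero_mem' := ⟨map_zero _, zero_mem _⟩
  smul_mem' e {x} hx := ⟨by rw [tensorFrob_smul, hx.1], D.smul_mem_filTensor 𝔅 e hx.2⟩

/-- Membership in `V_cris(D)`. [folklore] -/
lemma mem_Vcris_iff (x : D ⊗[𝔅.F₀] 𝔅.toPeriodRingData.B) :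
    x ∈ D.Vcris 𝔅 hσ ↔ D.tensorFrob 𝔅 hσ x = x ∧ x ∈ D.filTensor 𝔅 0 := Iff.rfl

/-- The action of `g ∈ Γ_F` on `D ⊗_{F₀} B` through the period ring (`id ⊗ g`), an
`F₀`-linear map.
Ref: BrinonConrad2009 §9.2 (`G_K` acts on `B_st ⊗ D` through `B_st`). [folklore] -/
def galTensor (g : absoluteGaloisGroup F) :
    D ⊗[𝔅.F₀] 𝔅.toPeriodRingData.B →ₗ[𝔅.F₀] D ⊗[𝔅.F₀] 𝔅.toPeriodRingData.B :=
  LinearMap.lTensor D (DistribSMul.toLinearMap 𝔅.F₀ 𝔅.toPeriodRingData.B g)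

/-- `galTensor` on pure tensors. [folklore] -/
@[simp] lemma galTensor_tmul (g : absoluteGaloisGroup F) (d : D) (b : 𝔅.toPeriodRingData.B) :
    D.galTensor 𝔅 g (d ⊗ₜ b) = d ⊗ₜ (g • b) := rfl

/-- `galTensor 1 = id`. [folklore] -/
lemma galTensor_one : D.galTensor 𝔅 1 = LinearMap.id := by
  refine TensorProduct.ext' fun d b => ?_
  rw [galTensor_tmul, one_smul, LinearMap.id_apply]

/-- `galTensor (g * h) = galTensor g ∘ galTensor h`. [folklore] -/
lemma galTensor_mul (g h : absoluteGaloisGroup F) :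
    D.galTensor 𝔅 (g * h) = D.galTensor 𝔅 g ∘ₗ D.galTensor 𝔅 h := by
  refine TensorProduct.ext' fun d b => ?_
  rw [LinearMap.comp_apply, galTensor_tmul, galTensor_tmul, galTensor_tmul, mul_smul]

/-- The Galois action is `E`-linear. [folklore] -/
lemma galTensor_smul (g : absoluteGaloisGroup F) (e : E) (x : D ⊗[𝔅.F₀] 𝔅.toPeriodRingData.B) :
    D.galTensor 𝔅 g (e • x) = e • D.galTensor 𝔅 g x := by
  induction x using TensorProduct.induction_on with
  | zero => simp
  | tmul d b => rw [smul_tmul', galTensor_tmul, galTensor_tmul, smul_tmul']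
  | add x y hx hy => rw [smul_add, map_add, map_add, smul_add, hx, hy]

/-- The Galois action commutes with the Frobenius `φ_D ⊗ φ_B` (since `𝔅.frob` is
`Γ_F`-equivariant). [folklore] -/
lemma tensorFrob_galTensor (g : absoluteGaloisGroup F) (x : D ⊗[𝔅.F₀] 𝔅.toPeriodRingData.B) :
    D.tensorFrob 𝔅 hσ (D.galTensor 𝔅 g x) = D.galTensor 𝔅 g (D.tensorFrob 𝔅 hσ x) := by
  induction x using TensorProduct.induction_on with
  | zero => simp
  | tmul d b => rw [galTensor_tmul, tensorFrob_tmul, tensorFrob_tmul, galTensor_tmul, 𝔅.frob_smul]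
  | add x y hx hy => rw [map_add, map_add, map_add, map_add, hx, hy]

/-- The Galois action preserves each `Filⁿ(D ⊗ B)` (each `Filʲ B` is `Γ_F`-stable). [folklore] -/
lemma galTensor_mem_filTensor (g : absoluteGaloisGroup F) {n : ℤ}
    {x : D ⊗[𝔅.F₀] 𝔅.toPeriodRingData.B} (hx : x ∈ D.filTensor 𝔅 n) :
    D.galTensor 𝔅 g x ∈ D.filTensor 𝔅 n := by
  refine D.map_filTensor_le 𝔅 (T := D.galTensor 𝔅 g) (fun i => ?_) (Submodule.mem_map_of_mem hx)
  exact ⟨TensorProduct.map LinearMap.id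
      ((DistribSMul.toLinearMap 𝔅.F₀ 𝔅.toPeriodRingData.B g).restrict
        (p := 𝔅.toPeriodRingData.fil (n - i)) (q := 𝔅.toPeriodRingData.fil (n - i))
        (fun x hx => 𝔅.toPeriodRingData.smul_mem_fil g (n - i) x hx)),
    TensorProduct.ext' fun _ _ => rfl⟩

/-- `V_cris(D)` is stable under `Γ_F`. [folklore] -/
lemma galTensor_mem_Vcris (g : absoluteGaloisGroup F) {x : D ⊗[𝔅.F₀] 𝔅.toPeriodRingData.B}
    (hx : x ∈ D.Vcris 𝔅 hσ) : D.galTensor 𝔅 g x ∈ D.Vcris 𝔅 hσ :=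
  ⟨by rw [tensorFrob_galTensor, hx.1], D.galTensor_mem_filTensor 𝔅 g hx.2⟩

/-- The action of `g ∈ Γ_F` on `V_cris(D)`, an `E`-linear endomorphism. [folklore] -/
def vcrisAct (g : absoluteGaloisGroup F) : D.Vcris 𝔅 hσ →ₗ[E] D.Vcris 𝔅 hσ where
  toFun x := ⟨D.galTensor 𝔅 g x, D.galTensor_mem_Vcris 𝔅 hσ g x.2⟩
  map_add' _ _ := Subtype.ext (map_add _ _ _)
  map_smul' e x := Subtype.ext (D.galTensor_smul 𝔅 g e x)

/-- Unfolding lemma for `vcrisAct`. [folklore] -/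
@[simp] lemma coe_vcrisAct_apply (g : absoluteGaloisGroup F) (x : D.Vcris 𝔅 hσ) :
    (D.vcrisAct 𝔅 hσ g x : D ⊗[𝔅.F₀] 𝔅.toPeriodRingData.B) = D.galTensor 𝔅 g x := rfl

/-- **The crystalline representation attached to a (weakly admissible) filtered `φ`-module**:
the `E`-linear representation of `Γ_F = Gal(F̄/F)` on
`V_cris(D) = Fil⁰(D ⊗_{F₀} B)^{φ=1}`, `g ↦ (id ⊗ g)|_{V_cris(D)}`, relative to the crystalline
period-ring datum `𝔅` (intended: `B_cris`, with `hσ` the restriction of its Frobenius to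
`F₀ = K₀`).  By the theorem of Colmez–Fontaine (ColmezFontaine2000, Théorème A: weakly
admissible ⇒ admissible), for `𝔅 = B_cris` and `D` weakly admissible of rank `n` over
`F₀ ⊗ E` this is an `n`-dimensional crystalline `E`-representation `V` with
`D_cris(V) ≅ D`, and `D ↦ V_cris(D)` is a quasi-inverse of `D_cris` (Guzman2024 Thm. 2.1.3);
e.g. `V_cris(D_{k,a_p}) = V_{k,a_p}^*` for Berger's `D_{k,a_p}` (Berger2011 §1:
`D_cris(V_{k,a_p}^*) = D_{k,a_p}`).  No
topology is imposed (the datum carries none; for `B_cris` continuity is automatic,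
BrinonConrad2009 Prop. 9.3.6); admissibility relative to `𝔅` is `IsAdmissible`.
Ref: BrinonConrad2009, (9.2.3) and Prop. 9.2.14, Prop. 9.3.9; ColmezFontaine2000, Thm. A. [cite: ColmezFontaine2000, Thm. A] -/
def crystallineRepOfWeaklyAdmissible :
    Representation E (absoluteGaloisGroup F) (D.Vcris 𝔅 hσ) where
  toFun := D.vcrisAct 𝔅 hσ
  map_one' := by
    refine LinearMap.ext fun x => Subtype.ext ?_
    rw [coe_vcrisAct_apply, galTensor_one]
    rfl
  map_mul' g h := by
    refine LinearMap.ext fun x => Subtype.ext ?_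
    rw [coe_vcrisAct_apply, galTensor_mul]
    rfl

/-- Unfolding lemma: `g` acts on `V_cris(D) ⊆ D ⊗ B` by `id ⊗ g`. [folklore] -/
@[simp] lemma coe_crystallineRepOfWeaklyAdmissible_apply (g : absoluteGaloisGroup F)
    (x : D.Vcris 𝔅 hσ) :
    (D.crystallineRepOfWeaklyAdmissible 𝔅 hσ g x : D ⊗[𝔅.F₀] 𝔅.toPeriodRingData.B) =
      D.galTensor 𝔅 g x := rfl

/-- `D` is **admissible** relative to the crystalline datum `𝔅` (Fontaine): `V_cris(D)` has
the maximal dimension `dim_P V_cris(D) = dim_{F₀} D` (for `B_cris`: always `≤`, with equality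
iff `D ≅ D_cris(V_cris(D))`, i.e. iff `D` comes from a crystalline representation).
Ref: BrinonConrad2009, Def. 9.3.8 and Prop. 9.3.9 (Colmez–Fontaine). [cite: BrinonConrad2009, Prop. 9.3.9] -/
def IsAdmissible (𝔅 : CrystallinePeriodRingData.{v, v', w} P F) {σ : 𝔅.F₀ →+* 𝔅.F₀}
    (hσ : ∀ e : 𝔅.F₀, 𝔅.frob (algebraMap 𝔅.F₀ 𝔅.toPeriodRingData.B e) =
      algebraMap 𝔅.F₀ 𝔅.toPeriodRingData.B (σ e))
    (D : FilteredPhiModule.{u, v, v', w'} P σ E) : Prop :=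
  Module.finrank P (D.Vcris 𝔅 hσ) = Module.finrank 𝔅.F₀ D

end FilteredPhiModule

/-- The **Colmez–Fontaine property** of the crystalline datum `𝔅` for coefficients `E`:
every weakly admissible filtered `φ`-module over `F₀ = 𝔅.F₀` with coefficients in `E` is
admissible relative to `𝔅` ("faiblement admissible ⇒ admissible").  For the genuine `B_cris`
this is Colmez–Fontaine's Théorème A (with Fontaine's converse, `D_cris` is then an
equivalence between crystalline `E`-representations of `Γ_F` and weakly admissible filtered
`φ`-modules, quasi-inverse `crystallineRepOfWeaklyAdmissible`).  A PREDICATE on the datum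
(its closure over all data is false, cf. `PeriodRingData.not_forall_isAdmissible`), to be
assumed by consumers next to `𝔅`; `v` is the `p`-adic valuation of `P` (for `P = ℚ_[p]`:
`Padic.addValuation`); `F₀ = 𝔅.F₀` must be finite over `P` (weak admissibility is computed
after restriction of scalars to `P`).  The carriers `D` range over the universe of `F` (no
loss: every filtered `φ`-module is isomorphic to one on `Fin n → F₀`-type carriers).
Ref: ColmezFontaine2000, Théorème A; BrinonConrad2009 §9.3 (Prop. 9.3.9 and the discussion
before Prop. 9.3.6); Guzman2024 Thm. 2.1.3 (with coefficients). [cite: ColmezFontaine2000, Thm. A] -/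
def CrystallinePeriodRingData.WeaklyAdmissibleImpliesAdmissible
    (𝔅 : CrystallinePeriodRingData.{v, v', w} P F) (σ : 𝔅.F₀ →+* 𝔅.F₀)
    (hσ : ∀ e : 𝔅.F₀, 𝔅.frob (algebraMap 𝔅.F₀ 𝔅.toPeriodRingData.B e) =
      algebraMap 𝔅.F₀ 𝔅.toPeriodRingData.B (σ e))
    (v : AddValuation P (WithTop ℤ)) (E : Type u) [Field E] [Algebra P E]
    [FiniteDimensional P 𝔅.F₀] : Prop :=
  ∀ D : FilteredPhiModule.{u, v, v', v'} P σ E, D.IsWeaklyAdmissible v → D.IsAdmissible 𝔅 hσ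

end Period

end Literature.NumberTheory.GaloisRepresentations
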